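import Mathlib
import HarnessLib
import Literature.Probability.MarkovChains.MetropolisHastings

/-!
# Mixtures of exact kernels are exact — when the mixing label is drawn independently of the state

HONEST FRAMING: exact (Metropolis-corrected) sampling algorithms for lattice gauge theory;
figures of merit are autocorrelation/cost numbers at stated couplings and volumes; no
continuum-physics claim.

Venture `LatticeQCDFlow` (cell pub-lqcd), topic `Exactness`; FANOUT row 9 (`eng-latcore`, the
`latflow.core` engine).  NEW WORK of the cell (elementary finite sums), not a published result;
nothing is cited as a fact.

## Content

`latflow.core` 0.2.1 introduced the `tau_jitter` lever (`phi4_2d.hmc(..., tau_jitter=j)`,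
`hmc.HMC.trajectory(..., tau_jitter=j)`): the HMC trajectory length is drawn as `τ(1 + j(2u − 1))`,
`u ~ U(0,1)`, BEFORE and INDEPENDENTLY of the current configuration, and the kernel of that length
is then applied.  The release notes justify its exactness in one clause — "a mixture of exact
kernels is exact".  This file is that clause, on a finite state space, together with the caveat
that makes the word "independently" load-bearing:

* `mixKernel w K x y = ∑ i, w i * K i x y` — draw a label `i` with weight `w i` (the same weights
  at every state), then move by `K i`;
* `mixKernel_detailedBalance` — if every `K i` is in detailed balance with `π`, so is the mixture
  (for ANY weights, normalised or not);
* `mixKernel_isStationary` — if every `K i` leaves `π` stationary and `∑ i, w i = 1`, the mixture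
  leaves `π` stationary;
* `mixKernel_sum_eq_one`, `mixKernel_nonneg` — it is a stochastic kernel when the `K i` are and
  `w` is a probability vector;
* `stateMixKernel w K x y = ∑ i, w x i * K i x y` — the same with STATE-DEPENDENT weights — and
  `stateMixKernel_not_isStationary_example`: on `Bool` with the uniform weight, mixing the identity
  kernel and the flip kernel (each uniform-stationary, indeed each in detailed balance) with weights
  "stay if `false`, flip if `true`" produces the kernel that sends everything to `false`, which is
  NOT uniform-stationary.  Choosing the trajectory length (or the scan order, or the number of
  over-relaxation hits) as a function of the current field is therefore not covered by the mixture
  argument; choosing it from an independent random stream is.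

Dictionary: `K i` = the HMC kernel (integrator + accept/reject) at trajectory length `τ_i`, each
exact on its own (`Literature.Probability.MarkovChains.HMCExpDeltaH`, `InvolutiveMetropolis.lean`);
`w` = the law of the jittered length; also random-scan sweeps and randomised `n_or`.
-/

namespace Summit.Ventures.LatticeQCDFlow.Exactness

open Finset
open Literature.Probability.MarkovChains

variable {X ι : Type*} [Fintype X] [Fintype ι]

/-- Mixture of the kernels `K i` with state-INDEPENDENT weights `w i`: draw the label, then move. -/
noncomputable def mixKernel (w : ι → ℝ) (K : ι → X → X → ℝ) (x y : X) : ℝ := ∑ i, w i * K i x y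

omit [Fintype X] in
/-- **Detailed balance survives mixing** (any weights): if every component is `π`-reversible, so is
the mixture. -/
theorem mixKernel_detailedBalance {π : X → ℝ} (w : ι → ℝ) {K : ι → X → X → ℝ}
    (h : ∀ i, DetailedBalance π (K i)) : DetailedBalance π (mixKernel w K) := by
  intro x y
  simp only [mixKernel, mul_sum]
  refine sum_congr rfl fun i _ => ?_
  calc π x * (w i * K i x y) = w i * (π x * K i x y) := by ring
    _ = w i * (π y * K i y x) := by rw [h i x y]
    _ = π y * (w i * K i y x) := by ring

/-- **Stationarity survives mixing** when the weights sum to one: if every component leaves `π`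
stationary, so does the mixture. -/
theorem mixKernel_isStationary {π : X → ℝ} {w : ι → ℝ} (hw : ∑ i, w i = 1) {K : ι → X → X → ℝ}
    (h : ∀ i, IsStationary π (K i)) : IsStationary π (mixKernel w K) := by
  intro y
  calc ∑ x, π x * mixKernel w K x y = ∑ x, ∑ i, w i * (π x * K i x y) := by
        refine sum_congr rfl fun x _ => ?_
        simp only [mixKernel, mul_sum]
        exact sum_congr rfl fun i _ => by ring
    _ = ∑ i, w i * ∑ x, π x * K i x y := by rw [sum_comm]; simp only [mul_sum]
    _ = ∑ i, w i * π y := sum_congr rfl fun i _ => by rw [h i y]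
    _ = π y := by rw [← sum_mul, hw, one_mul]

/-- Row sums of the mixture are one when `w` is normalised and every component is stochastic. -/
theorem mixKernel_sum_eq_one {w : ι → ℝ} (hw : ∑ i, w i = 1) {K : ι → X → X → ℝ}
    (hK : ∀ i x, ∑ y, K i x y = 1) (x : X) : ∑ y, mixKernel w K x y = 1 := by
  calc ∑ y, mixKernel w K x y = ∑ i, w i * ∑ y, K i x y := by
        simp only [mixKernel]; rw [sum_comm]; simp only [mul_sum]
    _ = ∑ i, w i := sum_congr rfl fun i _ => by rw [hK i x, mul_one]
    _ = 1 := hw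

omit [Fintype X] in
/-- The mixture is entrywise non-negative when the weights and the components are. -/
theorem mixKernel_nonneg {w : ι → ℝ} (hw : ∀ i, 0 ≤ w i) {K : ι → X → X → ℝ}
    (hK : ∀ i x y, 0 ≤ K i x y) (x y : X) : 0 ≤ mixKernel w K x y :=
  sum_nonneg fun i _ => mul_nonneg (hw i) (hK i x y)

/-- Mixture with STATE-DEPENDENT weights `w x i`: the label's law may depend on the current state.
NOT covered by the lemmas above — see the counterexample below. -/
noncomputable def stateMixKernel (w : X → ι → ℝ) (K : ι → X → X → ℝ) (x y : X) : ℝ :=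
  ∑ i, w x i * K i x y

omit [Fintype X] in
/-- With constant weights the state-dependent mixture is the plain mixture. -/
theorem stateMixKernel_const (w : ι → ℝ) (K : ι → X → X → ℝ) :
    stateMixKernel (fun _ => w) K = mixKernel w K := rfl

/-- The identity kernel on `Bool`. -/
def boolId (x y : Bool) : ℝ := if y = x then 1 else 0

/-- The deterministic flip kernel on `Bool`. -/
def boolFlip (x y : Bool) : ℝ := if y = !x then 1 else 0

/-- Both toy kernels, indexed by `Bool`: `false ↦ identity`, `true ↦ flip`. -/
def boolKernels : Bool → Bool → Bool → ℝ := fun i => if i then boolFlip else boolId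

/-- State-dependent weights "stay if `false`, flip if `true`": all mass on the label equal to the state. -/
def stayOrFlip (x i : Bool) : ℝ := if i = x then 1 else 0

/-- The identity kernel is in detailed balance with every weight. -/
theorem boolId_detailedBalance (π : Bool → ℝ) : DetailedBalance π boolId := by
  intro x y; by_cases h : y = x
  · subst h; rfl
  · simp [boolId, h, Ne.symm h]

/-- The flip kernel is in detailed balance with the uniform weight. -/
theorem boolFlip_detailedBalance : DetailedBalance (fun _ : Bool => (1 : ℝ)) boolFlip := by
  intro x y; cases x <;> cases y <;> simp [boolFlip]

/-- Each toy kernel leaves the uniform weight stationary. -/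
theorem boolKernels_isStationary (i : Bool) : IsStationary (fun _ : Bool => (1 : ℝ)) (boolKernels i) := by
  intro y; cases i <;> cases y <;> simp [boolKernels, boolId, boolFlip]

/-- The state-dependent weights are a probability vector at every state. -/
theorem stayOrFlip_sum (x : Bool) : ∑ i, stayOrFlip x i = 1 := by
  cases x <;> simp [stayOrFlip]

/-- The state-dependent mixture "stay if `false`, flip if `true`" is the kernel that sends every state
to `false`. -/
theorem stateMixKernel_stayOrFlip (x y : Bool) :
    stateMixKernel stayOrFlip boolKernels x y = if y = false then 1 else 0 := by
  cases x <;> cases y <;> simp [stateMixKernel, stayOrFlip, boolKernels, boolId, boolFlip]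

/-- **Counterexample: state-dependent mixing of exact kernels need not be exact.**  Every component is
uniform-stationary (indeed uniform-reversible) and the weights are normalised at every state, yet the
state-dependent mixture is not uniform-stationary (all mass flows to `false`). -/
theorem stateMixKernel_not_isStationary_example :
    (∀ i, IsStationary (fun _ : Bool => (1 : ℝ)) (boolKernels i)) ∧ (∀ x, ∑ i, stayOrFlip x i = 1) ∧
      ¬ IsStationary (fun _ : Bool => (1 : ℝ)) (stateMixKernel stayOrFlip boolKernels) := by
  refine ⟨boolKernels_isStationary, stayOrFlip_sum, fun h => ?_⟩
  have h1 := h true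
  simp [stateMixKernel_stayOrFlip] at h1

/-- By contrast the state-INDEPENDENT 50/50 mixture of the same two kernels is uniform-stationary
(an instance of `mixKernel_isStationary`). -/
theorem mixKernel_half_isStationary :
    IsStationary (fun _ : Bool => (1 : ℝ)) (mixKernel (fun _ : Bool => (1 / 2 : ℝ)) boolKernels) :=
  mixKernel_isStationary (by simp) boolKernels_isStationary

end Summit.Ventures.LatticeQCDFlow.Exactness
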